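import Summits.QuantumFields.BalabanUV.Beta.GAN24.TransportedDivFree
import Summits.QuantumFields.BalabanUV.Beta.GAN24.CombSlotResumTransport

/-!
# `BalabanUV.Beta.GAN24.ExitFaceWeightTransport` — binder row G-an2-4 ∕ (CONV-C), TRANSFER-III, the (III′) (C)-campaign's supplier `hB0` AT LEVELS `≥ 1`, the structural letter
# for the (Z)_comb ∕ «S3C-REC»-at-the-comb campaign: **EXIT-ROW-SUPPORTED SINGLE-COORDINATE WEIGHTS DO NOT SEE THE SLOT TRANSPORT AT ALL** — for a weight `f(x_α)` with
# `f k ≠ 0 ⟹ k ≡ −1 (mod n)` (every exit-face indicator `[k ≡ −1 (mod n·P)]` of ANY period `n·P`, not only the `n`-periodic one of leaf-01 g85 F7) the face potential of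
# `ClassWeightSlotTransport` VANISHES IDENTICALLY, because a slot bond on the exit row of its block CROSSES the face and carries no face weight (d1-leaf-03
# `SymCorrectorFace.faceWt_eq_zero_of_blk_ne`):  `Σ'_x f(x_α)·slotPsiS r n T α x = Σ'_x f(x_α)·T α x`.  Hence, with `TransportedDivFree` §2, the exit-face-weighted two-leg
# current of a transported table `𝒯S` IS the slot transport (in the free first leg) of the SAME current of `S` — and EQUALS it wherever that current is divergence-free.
# (G-an2-4 CRUX TEAM (2), leaf prover `b2b-balaban-gan24-formalise-leaf-01`, gen 87)

WHY (for the successor's (Z)_comb ∕ three-face campaign).  The descended weights of the (D)∕(Z)∕«3F-REC» towers are exit-face indicators of periods `Lc, Lc², …` in the slot's own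
direction (road-P2's `CoarseGaugeSourceResponse.tsum_coord_colH`: the `ℋ`-column answers a single-coordinate source on EXIT bonds only); they are NOT `Lc`-periodic beyond the first
period, so F7's periodic blindness does not apply — but they are exit-row supported, so THIS file's blindness does: on such data the comb member `𝒯 S̃comb_j` and `S̃comb_j` carry
the same currents (modulo the free leg's `slotPsiS`, which (D)_comb — `CombExitFaceCurrentDivFree` — removes).

NOT IN PRINT; OUR BOOKKEEPING ([folklore] BY NAME over `ClassWeightSlotTransport.tsum_coord_mul_slotPsiS`, `TransportedDivFree.current_transport_eq_slotPsiS`, d1-leaf-03's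
`SymCorrectorFace.faceWt_eq_zero_of_blk_ne`, `SymCorrectorFaceDiv.slotPsiS_eq_self_of_div_eq_zero`, leaf-02's `SymLinKernelFaceSupport.int_ediv_add_one`; generic `d`, `0 < n`,
`r ∈ box (d+1) n`; 0 `def`, 0 cited fact, 0 `def … : Prop`, 0 sorry).
HONEST FRAMING (cell contract, verbatim): «discharging `BetaPertH` makes Bałaban's UV stability UNCONDITIONAL — a real constructive-QFT result; it is NOT the continuum limit and NOT
the Clay problem.»  HONEST DEPENDENCY (verbatim): «continuum YM on T⁴ ⇐ BetaPertH ∧ nine spine estimates (0/9 proved); BetaPertH ⇐ (D1) ∧ (D4) ∧ CAP+tail; G-an2-4 gates asym, D1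
and NE2/3/4.»

## What is proved
* §1 **`facePot_eq_zero_of_exitRow`** (a bond on the exit row crosses the face — leaf-01 g84's `SymCorrectorExitFace.blk_add_unitVec_ne_of_exitFace`; (the face potential of an exit-row-supported weight vanishes).
* §2 **`tsum_exitRow_mul_slotPsiS`** (Form level) and `tsum_exitRow_mul_slotPsiS_kernel` (stencil entries): `Σ'_x f(x_α)·slotPsiS r n T α x = Σ'_x f(x_α)·T α x`.
* §3 **`exitRow_current_transport_eq_slotPsiS`**: for a local `S` and exit-row-supported bounded `f` (leg, direction `β`) and `g` (slot, direction `ν`):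
  `Σ'_q f(q_β)·Σ'_u g(u_ν)·(𝒯S) ν u v q (inl κ′)(inl β) = slotPsiS r n (κ₁ y ↦ Σ'_q f(q_β)·Σ'_u g(u_ν)·S ν u y q (inl κ₁)(inl β)) κ′ v`;
  **`exitRow_current_transport_eq_of_divFree`**: `= Σ'_q f(q_β)·Σ'_u g(u_ν)·S ν u v q (inl κ′)(inl β)` when that current of `S` is first-leg divergence-free.
* §4 both OUTER legs and the three-face form: `tsum_exitRow_mul_comp_psiKS_right`, `tsum_exitRow_mul_comp_trK_psiKS_left` (the exit-row twins of leaf-01 g85 F8 §2),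
  **`tsum_prod_exitRow_conj_psiKS`** (both legs of `Ψ̂ᵀ∘Z∘Ψ̂` drop under exit-row weights in the legs' own field directions; an exit-row SLOT is fixed
  pointwise by g84's `slotPsiS_eq_of_exitFace`), and **`threeFace_transport_eq`**: leaf-04 g62's three-face form — slot over the `γ`-exit face of one period-`n·P` cell, both legs against period-`n·P` exit indicators in
  their own directions — takes THE SAME VALUE on `𝒯S` and on `S`, for every local `S`, every `P ≥ 1`, hypothesis-free.
WHAT THIS IS NOT: NOT (Z)_comb; NOT `hB0`; NEVER «G-an2-4 closed» as (CONV-C); NOT D1, NOT `BetaPertH`, NOT continuum, NOT Clay.  2026-08-27; no existing file touched.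
-/

noncomputable section

open Finset
open scoped BigOperators
open Literature.MathematicalPhysics.QuantumFieldTheory
open Literature.MathematicalPhysics.QuantumFieldTheory.Balaban1983to89
open Literature.MathematicalPhysics.QuantumFieldTheory.Balaban1983to89.Beta
open ExpKernelCalculus (Site MKer comp BiLoc)
open OneStepResolventKernel (Fib LocStencil)
open AxialDressing (summable_col_of_biLoc summable_row_of_biLoc)
open AffineAveraging (Form1 box toSite unitVec)
open AveragingContours (blk)
open Summit.QuantumFields.BalabanUV.Beta.TameKernelCalculus (trK)
open Summit.QuantumFields.BalabanUV.Beta.SymCorrectorKernel (psiKS)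
open Summit.QuantumFields.BalabanUV.Beta.SymCorrectorFace (faceWt slotPsiS slotPsiS_apply_kernel faceWt_eq_zero_of_blk_ne)
open Summit.QuantumFields.BalabanUV.Beta.SymCorrectorFaceDiv (slotPsiS_eq_self_of_div_eq_zero)
open Summit.QuantumFields.BalabanUV.Beta.SymCorrectorSlot (comp_trK_psiKS_inl_left comp_psiKS_inl_right)
open Summit.QuantumFields.BalabanUV.Beta.GAN24.CombSlotResumTransport (exists_biLoc_conj_psiKS exists_biLoc_trK_psiKS_comp summable_prod_weight₂_of_biLoc tsum_prod_swap)
open Summit.QuantumFields.BalabanUV.Beta.GAN24.SymLinKernelFaceSupport (int_ediv_add_one)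
open Summit.QuantumFields.BalabanUV.Beta.GAN24.ClassWeightSlotTransport (tsum_coord_mul_slotPsiS)
open Summit.QuantumFields.BalabanUV.Beta.GAN24.TransportedDivFree (current_transport_eq_slotPsiS)
open Summit.QuantumFields.BalabanUV.Beta.GAN24.SymCorrectorExitFace (blk_add_unitVec_ne_of_exitFace slotPsiS_eq_of_exitFace)

namespace Summit.QuantumFields.BalabanUV.Beta.GAN24.ExitFaceWeightTransport

variable {d : ℕ} {n : ℕ} (hn : 0 < n) {r : Fin (d + 1) → ℕ} (hr : r ∈ box (d + 1) n)

/-! ## §1 Exit-row slot bonds carry no face weight -/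

section Pot

include hn

include hr

/-- NOT IN PRINT; OUR BOOKKEEPING ([folklore]).  **THE FACE POTENTIAL OF AN EXIT-ROW-SUPPORTED WEIGHT VANISHES**: if `f k ≠ 0 ⟹ k ≡ −1 (mod n)` then for every `m`,
`Σ_{b ∈ box} f(n·m + b_α)·faceWt r n α b = 0` (the only offsets `b` that contribute lie on the exit row, where the slot bond crosses the face). -/
theorem facePot_eq_zero_of_exitRow {f : ℤ → ℝ} (hf : ∀ k, f k ≠ 0 → k % (n : ℤ) = (n : ℤ) - 1) (α : Fin (d + 1)) (m : ℤ) :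
    ∑ b ∈ box (d + 1) n, f ((n : ℤ) * m + toSite b α) * faceWt r n α (toSite b) = 0 := by
  refine Finset.sum_eq_zero fun b hb => ?_
  by_cases h0 : f ((n : ℤ) * m + toSite b α) = 0
  · rw [h0, zero_mul]
  · have hk := hf _ h0
    have hx : toSite b α % (n : ℤ) = (n : ℤ) - 1 := by
      have e : ((n : ℤ) * m + toSite b α) % (n : ℤ) = toSite b α % (n : ℤ) := by
        rw [add_comm, Int.add_mul_emod_self_left]
      rw [← e, hk]
    rw [faceWt_eq_zero_of_blk_ne hn hr (blk_add_unitVec_ne_of_exitFace hn hx), mul_zero]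

end Pot

/-! ## §2 Exit-row-weighted slot sums do not see the slot transport -/

section Slot

include hn hr

/-- NOT IN PRINT; OUR BOOKKEEPING ([folklore]).  **AN EXIT-ROW-WEIGHTED SLOT SUM IS BLIND TO THE SLOT TRANSPORT** — for a bond family `T` with summable components and a bounded
`f : ℤ → ℝ` supported on `{k ≡ −1 (mod n)}` (any period: `[k ≡ −1 (mod n·P)]` for every `P ≥ 1`): `Σ'_x f(x_α)·slotPsiS r n T α x = Σ'_x f(x_α)·T α x`. -/
theorem tsum_exitRow_mul_slotPsiS {T : Form1 (d + 1) ℝ} (hT : ∀ κ, Summable (T κ)) {f : ℤ → ℝ} {B : ℝ} (hfb : ∀ k, |f k| ≤ B)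
    (hf : ∀ k, f k ≠ 0 → k % (n : ℤ) = (n : ℤ) - 1) (α : Fin (d + 1)) :
    ∑' x, f (x α) * slotPsiS r n T α x = ∑' x, f (x α) * T α x := by
  rw [tsum_coord_mul_slotPsiS hn r hT hfb α]
  refine tsum_congr fun x => ?_
  rw [facePot_eq_zero_of_exitRow hn hr hf α, facePot_eq_zero_of_exitRow hn hr hf α, sub_self, add_zero]

/-- [folklore] … entrywise for stencil families. -/
theorem tsum_exitRow_mul_slotPsiS_kernel {S : Fin (d + 1) → Site (d + 1) → MKer (d + 1) (Fib d)} (p q : Site (d + 1)) (a b : Fib d)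
    (hS : ∀ κ, Summable fun x => S κ x p q a b) {f : ℤ → ℝ} {B : ℝ} (hfb : ∀ k, |f k| ≤ B) (hf : ∀ k, f k ≠ 0 → k % (n : ℤ) = (n : ℤ) - 1) (α : Fin (d + 1)) :
    ∑' x, f (x α) * slotPsiS r n S α x p q a b = ∑' x, f (x α) * S α x p q a b := by
  have e : ∀ x, slotPsiS r n S α x p q a b = slotPsiS r n (fun κ u => S κ u p q a b) α x := fun x => slotPsiS_apply_kernel r n S α x p q a b
  simp only [e]
  exact tsum_exitRow_mul_slotPsiS hn hr (T := fun κ u => S κ u p q a b) hS hfb hf α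

end Slot

/-! ## §3 Exit-face-weighted currents of a transported table -/

section Current

variable {S : Fin (d + 1) → Site (d + 1) → MKer (d + 1) (Fib d)} {Cs δs : ℝ}

include hn hr

/-- NOT IN PRINT; OUR BOOKKEEPING ([folklore]).  **THE EXIT-ROW-WEIGHTED TWO-LEG CURRENT OF `𝒯S` IS THE FIRST-LEG SLOT TRANSPORT OF THE SAME CURRENT OF `S`**: for a local `S`,
bounded exit-row-supported `f` (leg weight, direction `β`) and `g` (slot weight, direction `ν`), all `κ′ v`:
`Σ'_q f(q_β)·Σ'_u g(u_ν)·(Ψ̂ᵀ∘slotPsiS S ν u∘Ψ̂) v q (inl κ′)(inl β) = slotPsiS r n (κ₁ y ↦ Σ'_q f(q_β)·Σ'_u g(u_ν)·S ν u y q (inl κ₁)(inl β)) κ′ v`. -/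
theorem exitRow_current_transport_eq_slotPsiS (hS : LocStencil S Cs δs) (hδs : 0 < δs) {f g : ℤ → ℝ} {Bf Bg : ℝ} (hfb : ∀ k, |f k| ≤ Bf) (hgb : ∀ k, |g k| ≤ Bg)
    (hf : ∀ k, f k ≠ 0 → k % (n : ℤ) = (n : ℤ) - 1) (hg : ∀ k, g k ≠ 0 → k % (n : ℤ) = (n : ℤ) - 1) (ν β κ' : Fin (d + 1)) (v : Site (d + 1)) :
    ∑' q : Site (d + 1), f (q β) * ∑' u : Site (d + 1), g (u ν) * comp (comp (trK (psiKS r n)) (slotPsiS r n S ν u)) (psiKS r n) v q (Sum.inl κ') (Sum.inl β)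
      = slotPsiS r n (fun κ₁ y => ∑' q : Site (d + 1), f (q β) * ∑' u : Site (d + 1), g (u ν) * S ν u y q (Sum.inl κ₁) (Sum.inl β)) κ' v :=
  current_transport_eq_slotPsiS hn hr hS hδs (ρ := fun q => f (q β)) (ρ' := fun q => f (q β)) (σ := fun u => g (u ν)) (σ' := fun u => g (u ν))
    (fun q => hfb (q β)) (fun u => hgb (u ν)) (fun u => hgb (u ν)) ν β
    (fun _ hT => tsum_exitRow_mul_slotPsiS hn hr hT hgb hg ν) (fun _ hT => tsum_exitRow_mul_slotPsiS hn hr hT hfb hf β) κ' v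

/-- NOT IN PRINT; OUR BOOKKEEPING ([folklore]).  **… AND EQUALS IT WHERE THAT CURRENT IS DIVERGENCE-FREE**: if `Σ_κ (I(κ, x − e_κ) − I(κ, x)) = 0` for all `x`
(`I(κ₁,y) = Σ'_q f(q_β)·Σ'_u g(u_ν)·S ν u y q (inl κ₁)(inl β)`), then the exit-row-weighted current of `𝒯S` IS `I` — the transport is invisible. -/
theorem exitRow_current_transport_eq_of_divFree (hS : LocStencil S Cs δs) (hδs : 0 < δs) {f g : ℤ → ℝ} {Bf Bg : ℝ} (hfb : ∀ k, |f k| ≤ Bf) (hgb : ∀ k, |g k| ≤ Bg)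
    (hf : ∀ k, f k ≠ 0 → k % (n : ℤ) = (n : ℤ) - 1) (hg : ∀ k, g k ≠ 0 → k % (n : ℤ) = (n : ℤ) - 1) (ν β : Fin (d + 1))
    (hdiv : ∀ x : Site (d + 1), ∑ κ : Fin (d + 1),
      ((∑' q : Site (d + 1), f (q β) * ∑' u : Site (d + 1), g (u ν) * S ν u (x - unitVec κ) q (Sum.inl κ) (Sum.inl β))
        - ∑' q : Site (d + 1), f (q β) * ∑' u : Site (d + 1), g (u ν) * S ν u x q (Sum.inl κ) (Sum.inl β)) = 0)
    (κ' : Fin (d + 1)) (v : Site (d + 1)) :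
    ∑' q : Site (d + 1), f (q β) * ∑' u : Site (d + 1), g (u ν) * comp (comp (trK (psiKS r n)) (slotPsiS r n S ν u)) (psiKS r n) v q (Sum.inl κ') (Sum.inl β)
      = ∑' q : Site (d + 1), f (q β) * ∑' u : Site (d + 1), g (u ν) * S ν u v q (Sum.inl κ') (Sum.inl β) := by
  rw [exitRow_current_transport_eq_slotPsiS hn hr hS hδs hfb hgb hf hg ν β κ' v,
    slotPsiS_eq_self_of_div_eq_zero hn r (T := fun κ₁ y => ∑' q : Site (d + 1), f (q β) * ∑' u : Site (d + 1), g (u ν) * S ν u y q (Sum.inl κ₁) (Sum.inl β)) hdiv]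

end Current

/-! ## §4 Both outer legs; the three-face form is blind to the transport -/

section Legs

include hn hr

/-- [folklore] **RIGHT CORRECTOR LEG, EXIT-ROW WEIGHT IN THE LEG's OWN FIELD DIRECTION**: for `X` with summable rows at `(x, a)`,
`Σ'_w f(w_β)·(X ∘ Ψ̂_S)(x,w)(a, inl β) = Σ'_w f(w_β)·X(x,w)(a, inl β)` (TT3b `comp_psiKS_inl_right` ⨾ §2). -/
theorem tsum_exitRow_mul_comp_psiKS_right (X : MKer (d + 1) (Fib d)) (x : Site (d + 1)) (a : Fib d) (β : Fin (d + 1))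
    (hX : ∀ b' : Fib d, Summable fun w => X x w a b') {f : ℤ → ℝ} {B : ℝ} (hfb : ∀ k, |f k| ≤ B) (hf : ∀ k, f k ≠ 0 → k % (n : ℤ) = (n : ℤ) - 1) :
    ∑' w, f (w β) * comp X (psiKS r n) x w a (Sum.inl β) = ∑' w, f (w β) * X x w a (Sum.inl β) := by
  rw [tsum_congr fun w => by rw [comp_psiKS_inl_right hn hr X x w a β]]
  exact tsum_exitRow_mul_slotPsiS hn hr (T := fun κ u => X x u a (Sum.inl κ)) (fun κ => hX (Sum.inl κ)) hfb hf β

/-- [folklore] **LEFT TRANSPOSED CORRECTOR LEG, EXIT-ROW WEIGHT IN THE LEG's OWN FIELD DIRECTION**: for `X` with summable columns at `(w, b)`,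
`Σ'_y f(y_α)·(Ψ̂_Sᵀ ∘ X)(y,w)(inl α, b) = Σ'_y f(y_α)·X(y,w)(inl α, b)` (TT3b `comp_trK_psiKS_inl_left` ⨾ §2). -/
theorem tsum_exitRow_mul_comp_trK_psiKS_left (X : MKer (d + 1) (Fib d)) (w : Site (d + 1)) (α : Fin (d + 1)) (b : Fib d)
    (hX : ∀ a' : Fib d, Summable fun y => X y w a' b) {f : ℤ → ℝ} {B : ℝ} (hfb : ∀ k, |f k| ≤ B) (hf : ∀ k, f k ≠ 0 → k % (n : ℤ) = (n : ℤ) - 1) :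
    ∑' y, f (y α) * comp (trK (psiKS r n)) X y w (Sum.inl α) b = ∑' y, f (y α) * X y w (Sum.inl α) b := by
  rw [tsum_congr fun y => by rw [comp_trK_psiKS_inl_left hn hr X y w α b]]
  exact tsum_exitRow_mul_slotPsiS hn hr (T := fun κ u => X u w (Sum.inl κ) b) (fun κ => hX (Sum.inl κ)) hfb hf α

/-- NOT IN PRINT; OUR BOOKKEEPING ([folklore]).  **BOTH OUTER LEGS OF A TRANSPORTED KERNEL DROP UNDER EXIT-ROW WEIGHTS IN THE LEGS' OWN FIELD DIRECTIONS**: for `Z` bi-localised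
(rate `δ > 0`) and bounded exit-row-supported `f g : ℤ → ℝ`,
`Σ'_{(y,w)} f(y_α)·g(w_β)·(Ψ̂_Sᵀ ∘ Z ∘ Ψ̂_S)(y,w)(inl α)(inl β) = Σ'_{(y,w)} f(y_α)·g(w_β)·Z(y,w)(inl α)(inl β)` — the exit-row twin of leaf-01 g85 F8 `tsum_prod_weight_conj_psiKS`. -/
theorem tsum_prod_exitRow_conj_psiKS {Z : MKer (d + 1) (Fib d)} {p q : Site (d + 1)} {C δ : ℝ} (hZ : BiLoc Z p q C δ) (hδ : 0 < δ)
    {f g : ℤ → ℝ} {Bf Bg : ℝ} (hfb : ∀ k, |f k| ≤ Bf) (hf : ∀ k, f k ≠ 0 → k % (n : ℤ) = (n : ℤ) - 1)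
    (hgb : ∀ k, |g k| ≤ Bg) (hg : ∀ k, g k ≠ 0 → k % (n : ℤ) = (n : ℤ) - 1) (α β : Fin (d + 1)) :
    ∑' yw : Site (d + 1) × Site (d + 1), f (yw.1 α) * g (yw.2 β) * comp (comp (trK (psiKS r n)) Z) (psiKS r n) yw.1 yw.2 (Sum.inl α) (Sum.inl β)
      = ∑' yw : Site (d + 1) × Site (d + 1), f (yw.1 α) * g (yw.2 β) * Z yw.1 yw.2 (Sum.inl α) (Sum.inl β) := by
  obtain ⟨C₂, hZ₂⟩ := exists_biLoc_conj_psiKS hn hr hZ hδ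
  obtain ⟨C₁, hZ₁⟩ := exists_biLoc_trK_psiKS_comp hn hr hZ hδ
  have hδ₂ : 0 < δ / 4 := by positivity
  have hδ₁ : 0 < δ / 2 := by positivity
  have h₁ : ∀ y : Site (d + 1), |f (y α)| ≤ Bf := fun y => hfb (y α)
  have h₂ : ∀ w : Site (d + 1), |g (w β)| ≤ Bg := fun w => hgb (w β)
  set M := comp (trK (psiKS r n)) Z with hM
  -- step 1: the right leg, row by row
  have step1 : ∑' yw : Site (d + 1) × Site (d + 1), f (yw.1 α) * g (yw.2 β) * comp M (psiKS r n) yw.1 yw.2 (Sum.inl α) (Sum.inl β)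
      = ∑' yw : Site (d + 1) × Site (d + 1), f (yw.1 α) * g (yw.2 β) * M yw.1 yw.2 (Sum.inl α) (Sum.inl β) := by
    rw [(summable_prod_weight₂_of_biLoc hZ₂ hδ₂ h₁ h₂ (Sum.inl α) (Sum.inl β)).tsum_prod,
      (summable_prod_weight₂_of_biLoc hZ₁ hδ₁ h₁ h₂ (Sum.inl α) (Sum.inl β)).tsum_prod]
    refine tsum_congr fun y => ?_
    simp only [mul_assoc]
    rw [tsum_mul_left, tsum_mul_left, tsum_exitRow_mul_comp_psiKS_right hn hr M y (Sum.inl α) β (fun b' => summable_row_of_biLoc hZ₁ hδ₁ y (Sum.inl α) b') hgb hg]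
  -- step 2: the left leg, column by column, after swapping the legs
  have step2 : ∑' wy : Site (d + 1) × Site (d + 1), f (wy.2 α) * g (wy.1 β) * M wy.2 wy.1 (Sum.inl α) (Sum.inl β)
      = ∑' wy : Site (d + 1) × Site (d + 1), f (wy.2 α) * g (wy.1 β) * Z wy.2 wy.1 (Sum.inl α) (Sum.inl β) := by
    have hsM : Summable fun wy : Site (d + 1) × Site (d + 1) => f (wy.2 α) * g (wy.1 β) * M wy.2 wy.1 (Sum.inl α) (Sum.inl β) :=
      ((summable_prod_weight₂_of_biLoc hZ₁ hδ₁ h₁ h₂ (Sum.inl α) (Sum.inl β)).comp_injective (Equiv.prodComm (Site (d + 1)) (Site (d + 1))).injective).congr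
        fun wy => rfl
    have hsZ : Summable fun wy : Site (d + 1) × Site (d + 1) => f (wy.2 α) * g (wy.1 β) * Z wy.2 wy.1 (Sum.inl α) (Sum.inl β) :=
      ((summable_prod_weight₂_of_biLoc hZ hδ h₁ h₂ (Sum.inl α) (Sum.inl β)).comp_injective (Equiv.prodComm (Site (d + 1)) (Site (d + 1))).injective).congr
        fun wy => rfl
    rw [hsM.tsum_prod, hsZ.tsum_prod]
    refine tsum_congr fun w => ?_
    have e : ∀ (K : MKer (d + 1) (Fib d)) (y : Site (d + 1)), f (y α) * g (w β) * K y w (Sum.inl α) (Sum.inl β) = g (w β) * (f (y α) * K y w (Sum.inl α) (Sum.inl β)) :=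
      fun K y => by ring
    simp only [e]
    rw [tsum_mul_left, tsum_mul_left, hM, tsum_exitRow_mul_comp_trK_psiKS_left hn hr Z w α (Sum.inl β) (fun a' => summable_col_of_biLoc hZ hδ w a' (Sum.inl β)) hfb hf]
  rw [step1, tsum_prod_swap (fun y w => f (y α) * g (w β) * M y w (Sum.inl α) (Sum.inl β)), step2,
    ← tsum_prod_swap (fun y w => f (y α) * g (w β) * Z y w (Sum.inl α) (Sum.inl β))]

/-- NOT IN PRINT; OUR BOOKKEEPING ([folklore]; **THE THREE-FACE FORM IS BLIND TO THE TRANSPORT**).  For a local stencil family `S`, every `P ≥ 1` and all `(γ, α, β)`: leaf-04 g62's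
three-face-legs cell form with period-`n·P` exit faces takes the same value on `𝒯S = Ψ̂_Sᵀ ∘ slotPsiS S ∘ Ψ̂_S` and on `S`:
`Σ_{v ∈ box (n·P)} χ_γ(v)·Σ'_{(y,w)} χ_α(y)·χ_β(w)·(𝒯S) γ v y w (inl α)(inl β) = Σ_{v ∈ box (n·P)} χ_γ(v)·Σ'_{(y,w)} χ_α(y)·χ_β(w)·S γ v y w (inl α)(inl β)`,
`χ_κ(x) = [x_κ ≡ −1 (mod n·P)]` — the slot pointwise (exit-row slot), the legs by `tsum_prod_exitRow_conj_psiKS`.  No hypothesis on `S` beyond locality. -/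
theorem threeFace_transport_eq {S : Fin (d + 1) → Site (d + 1) → MKer (d + 1) (Fib d)} {Cs δs : ℝ} (hS : LocStencil S Cs δs) (hδs : 0 < δs)
    (P : ℕ) (γ α β : Fin (d + 1)) :
    ∑ v ∈ box (d + 1) (n * P), (if toSite v γ % ((n * P : ℕ) : ℤ) = ((n * P : ℕ) : ℤ) - 1 then (1 : ℝ) else 0) *
        ∑' yw : Site (d + 1) × Site (d + 1),
          (if yw.1 α % ((n * P : ℕ) : ℤ) = ((n * P : ℕ) : ℤ) - 1 then (1 : ℝ) else 0) * (if yw.2 β % ((n * P : ℕ) : ℤ) = ((n * P : ℕ) : ℤ) - 1 then (1 : ℝ) else 0) *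
            comp (comp (trK (psiKS r n)) (slotPsiS r n S γ (toSite v))) (psiKS r n) yw.1 yw.2 (Sum.inl α) (Sum.inl β)
      = ∑ v ∈ box (d + 1) (n * P), (if toSite v γ % ((n * P : ℕ) : ℤ) = ((n * P : ℕ) : ℤ) - 1 then (1 : ℝ) else 0) *
        ∑' yw : Site (d + 1) × Site (d + 1),
          (if yw.1 α % ((n * P : ℕ) : ℤ) = ((n * P : ℕ) : ℤ) - 1 then (1 : ℝ) else 0) * (if yw.2 β % ((n * P : ℕ) : ℤ) = ((n * P : ℕ) : ℤ) - 1 then (1 : ℝ) else 0) *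
            S γ (toSite v) yw.1 yw.2 (Sum.inl α) (Sum.inl β) := by
  have hn0 : (0 : ℤ) < (n : ℤ) := by exact_mod_cast hn
  -- the period-`n·P` exit indicator is exit-row supported (mod `n`) and bounded
  have hmod : ∀ k : ℤ, k % ((n * P : ℕ) : ℤ) = ((n * P : ℕ) : ℤ) - 1 → k % (n : ℤ) = (n : ℤ) - 1 := by
    intro k hk
    have hmP : ((n * P : ℕ) : ℤ) ∣ k + 1 := by
      refine ⟨k / ((n * P : ℕ) : ℤ) + 1, ?_⟩
      have h := Int.emod_add_mul_ediv k ((n * P : ℕ) : ℤ)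
      rw [hk] at h
      linear_combination (-1 : ℤ) * h
    obtain ⟨e, he⟩ : (n : ℤ) ∣ k + 1 := Dvd.dvd.trans ⟨(P : ℤ), by push_cast; ring⟩ hmP
    have hk' : k = ((n : ℤ) - 1) + (n : ℤ) * (e - 1) := by linear_combination he
    rw [hk', Int.add_mul_emod_self_left]
    exact Int.emod_eq_of_lt (by omega) (by omega)
  set χ : ℤ → ℝ := fun k => if k % ((n * P : ℕ) : ℤ) = ((n * P : ℕ) : ℤ) - 1 then (1 : ℝ) else 0 with hχ
  have hχb : ∀ k, |χ k| ≤ 1 := fun k => by simp only [hχ]; split_ifs <;> simp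
  have hχs : ∀ k, χ k ≠ 0 → k % (n : ℤ) = (n : ℤ) - 1 := fun k hk => by
    simp only [hχ] at hk
    by_cases h : k % ((n * P : ℕ) : ℤ) = ((n * P : ℕ) : ℤ) - 1
    · exact hmod k h
    · exact absurd (if_neg h) hk
  refine Finset.sum_congr rfl fun v _ => ?_
  by_cases hv : toSite v γ % ((n * P : ℕ) : ℤ) = ((n * P : ℕ) : ℤ) - 1
  swap
  · rw [if_neg hv, zero_mul, zero_mul]
  rw [slotPsiS_eq_of_exitFace hn hr S (hmod _ hv)]
  congr 1
  exact tsum_prod_exitRow_conj_psiKS hn hr (hS γ (toSite v)) hδs (f := χ) (g := χ) hχb hχs hχb hχs α β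

end Legs

end Summit.QuantumFields.BalabanUV.Beta.GAN24.ExitFaceWeightTransport

end
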